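import Summits.CriticalPhenomena.Ising3DConformalLimit.Theorems.PlantedPinningGaussianPinningSaturationDefs
import Literature.Probability.LatticeModels.CriticalTwoPointBounds

/-!
# Thermodynamic limit of the truncated box two-point function at `β_c(3)` (stub F1 `stub_boxCovTendsto`)

Stub F1 of the line `birth` (linear-benchmark split `e = e^{lin} − e^{gap}`) for the crux
`GaussianPinningSaturation` (item stmt-CriticalPhenomena-8452): the common currency of the
kernel-level stubs B1/B2/C, namely the route-posited statement `BoxCovTendsto` of the `…Defs` file.

**Statement** (`stub_boxCovTendsto`): for all sites `x, y ∈ ℤ³`,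
`Cov⁺_{Λ_L;β_c(3),0}(σ_x, σ_y) → ⟨σ₀σ_{y−x}⟩⁺_{β_c(3),0} = criticalTwoPoint 3 (y − x)` as `L → ∞`,
where `Λ_L = box 3 L = [-L,L]³` and
`cov L x y = ⟨σ_xσ_y⟩⁺_{Λ_L} − ⟨σ_x⟩⁺_{Λ_L}⟨σ_y⟩⁺_{Λ_L}` at `β = β_c(3)`, `h = 0`, `+` boundary
condition (`plusE`, `cov` of the `…Defs` file).

**Proof** (every input is a theorem of `Literature.Probability.LatticeModels`):
* the plus state is the box limit of the finite-volume `+` states on spin products (GKS II volume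
  monotonicity; Friedli–Velenik 2017, Thm. 3.17): `⟨σ_xσ_y⟩⁺_{Λ_L} → ⟨σ_xσ_y⟩⁺_{β_c}`
  (`tendsto_isingExpect_plus_spinPair hasBoxLimit_isingCorr_plus_holds`) and
  `⟨σ_x⟩⁺_{Λ_L} → ⟨σ_x⟩⁺_{β_c}` (`tendsto_isingExpect_plus_spinAt`);
* `⟨σ_x⟩⁺_{β_c} = m*(β_c(3)) = 0`: translation invariance of the plus state
  (`plusExpect_spinAt_eq_spontaneousMagnetization_holds`; Friedli–Velenik 2017, Thm. 3.17) and
  continuity of the magnetisation at criticality in `d = 3` (Aizenman–Duminil-Copin–Sidoravicius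
  2015, Thm. 1.2 with Cor. 1.5 (1); `spontaneousMagnetization_criticalBeta_eq_zero_holds`);
* `⟨σ_xσ_y⟩⁺_{β_c} = ⟨σ₀σ_{y−x}⟩⁺_{β_c}`: translation invariance of the plus pair correlation
  (`plusPair_eq_twoPointPlus_sub`), and `criticalTwoPoint 3 = twoPointPlus 3 (criticalBeta 3)` by
  definition;
* algebra of limits (`Filter.Tendsto.sub`, `Filter.Tendsto.mul`).

References: S. Friedli, Y. Velenik, *Statistical Mechanics of Lattice Systems* (2017), Thm. 3.17;
M. Aizenman, H. Duminil-Copin, V. Sidoravicius, Comm. Math. Phys. 334 (2015), Thm. 1.2.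
-/

noncomputable section

namespace Summit.CriticalPhenomena.Ising3DConformalLimit.PlantedPinningGaussianPinningSaturation

open scoped BigOperators Classical Topology
open Finset MeasureTheory Filter
open Literature.Probability.LatticeModels
open Summit.CriticalPhenomena.Ising3DConformalLimit.Theses.PlantedPinning

/-- `⟨σ_z⟩⁺_{β_c(3),0} = m*(β_c(3)) = 0` for every site `z ∈ ℤ³` (translation invariance of the
plus state, Friedli–Velenik 2017, Thm. 3.17; `m*(β_c) = 0` in `d = 3`,
Aizenman–Duminil-Copin–Sidoravicius 2015, Thm. 1.2). -/
private theorem plusExpect_spinAt_criticalBeta_eq_zero (z : Site 3) :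
    plusExpect 3 (criticalBeta 3) 0 (spinAt z) = 0 :=
  (plusExpect_spinAt_eq_spontaneousMagnetization_holds (criticalBeta_nonneg 3) z).trans
    (spontaneousMagnetization_criticalBeta_eq_zero_holds (d := 3) le_rfl)

/-- **Stub `stub_boxCovTendsto`** (registered signature, verbatim): the truncated two-point
function of the critical `+` box converges to the critical two-point function,
`Cov⁺_{Λ_L}(σ_x,σ_y) → ⟨σ₀σ_{y−x}⟩⁺_{β_c(3)}` as `L → ∞`. -/
theorem stub_boxCovTendsto :
    ∀ x y : Site 3,
      Filter.Tendsto (fun L : ℕ => cov L x y) Filter.atTop (nhds (criticalTwoPoint 3 (y - x))) := by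
  intro x y
  have hβ : 0 ≤ criticalBeta 3 := criticalBeta_nonneg 3
  -- box limits of `⟨σ_xσ_y⟩⁺_{Λ_L}`, `⟨σ_x⟩⁺_{Λ_L}`, `⟨σ_y⟩⁺_{Λ_L}` (existence of the plus state)
  have hpair := tendsto_isingExpect_plus_spinPair (d := 3) hasBoxLimit_isingCorr_plus_holds hβ x y
  have hx := tendsto_isingExpect_plus_spinAt (d := 3) hasBoxLimit_isingCorr_plus_holds hβ x
  have hy := tendsto_isingExpect_plus_spinAt (d := 3) hasBoxLimit_isingCorr_plus_holds hβ y
  -- identification of the limit: `⟨σ_xσ_y⟩⁺ − ⟨σ_x⟩⁺⟨σ_y⟩⁺ = ⟨σ₀σ_{y−x}⟩⁺ − 0·0`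
  have hlim : criticalTwoPoint 3 (y - x) =
      plusPair 3 (criticalBeta 3) x y -
        plusExpect 3 (criticalBeta 3) 0 (spinAt x) * plusExpect 3 (criticalBeta 3) 0 (spinAt y) := by
    rw [plusExpect_spinAt_criticalBeta_eq_zero x, plusExpect_spinAt_criticalBeta_eq_zero y,
      mul_zero, sub_zero, plusPair_eq_twoPointPlus_sub hβ x y]
    rfl
  rw [hlim]
  exact hpair.sub (hx.mul hy)

end Summit.CriticalPhenomena.Ising3DConformalLimit.PlantedPinningGaussianPinningSaturation

end
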